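import Literature.NumberTheory.LFunctions.ZetaFractionalPartIntegral
import Mathlib.NumberTheory.Harmonic.ZetaAsymp
import Mathlib.Analysis.Real.Pi.Bounds
import HarnessLib

/-!
# Lehman's bound `|ζ(½+it)| ≤ 2.53 t^{1/4}` (Trudgian 2011, Lemma 2.5) — named fact, and the
# all-`t` critical-line hypothesis of Turing's method derived from it

Trunk T-ANT (`NumberTheory/LFunctions`), family RH.  The one input of Turing's method with
Trudgian's constants that rests on the Riemann–Siegel formula with explicit remainder
(Titchmarsh 1935 / Lehman 1970; not in Mathlib or the tree): [Trudgian 2011, Lemma 2.5]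
"If `t ≥ 128π`, then `|ζ(½+it)| ≤ 2.53 t^{1/4}`" (Lehman: `4(t/2π)^{1/4}`, `4(2π)^{−1/4} = 2.526…`),
together with the remark in footnote 3 of that paper: "A computational check shows that Lemma 2.5
in fact holds for all `t > 1`."  Both are vendored as NAMED FACTS (users take `(h : …)`):

* `Literature.NumberTheory.LFunctions.Trudgian2011_lemma_2_5` — the lemma as printed (`t ≥ 128π`);
* `Literature.NumberTheory.LFunctions.Trudgian2011_lemma_2_5_allT` — the footnote's extension (`t > 1`).

From the latter we PROVE the hypothesis in the shape consumed by the Phragmén–Lindelöf step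
(`ZetaConvexityExplicit.lean`, `TuringLowerBound.lean`), on the *whole* line:

* `Literature.NumberTheory.LFunctions.norm_riemannZeta_half_line_le_allT` —
  `∀ u, |ζ(½+iu)| ≤ 2.53 · |5/2 + ½ + iu|^{1/4}` (`Q = 5/2`, `K = 2.53`, `θ = ¼`): for `|u| > 1` by
  the fact and `ζ(s̄) = conj ζ(s)`, `|u| ≤ |3 + iu|`; for `|u| ≤ 1` from the elementary bound
  `|ζ(s)| ≤ |s|/|s−1| + |s|/σ` (`ZetaFractionalPartIntegral.lean`: `≤ 1 + √5 < 2.53·3^{1/4}`).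
  The shift `Q = 5/2` costs nothing in Theorem 2.12 (it enters only through
  `(Q+c)²/(2t₀²) ≈ 2·10⁻⁵`).

## References

* T. S. Trudgian, *Improvements to Turing's method*, Math. Comp. 80 (2011), Lemma 2.5 and
  footnote 3.  [Trudgian2011]
* R. S. Lehman, *On the distribution of zeros of the Riemann zeta-function*, Proc. LMS (3) 20
  (1970), §3 (corrections to Titchmarsh's explicit Riemann–Siegel remainder).  [Lehman1970]
-/

noncomputable section

open Complex Real
open scoped ComplexConjugate

namespace Literature.NumberTheory.LFunctions

/-- NAMED FACT (**Trudgian 2011, Lemma 2.5**; Lehman 1970): if `t ≥ 128π` then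
`|ζ(½ + it)| ≤ 2.53 t^{1/4}`.  Users take `(h : Trudgian2011_lemma_2_5)`.
[cite: Trudgian2011, Lemma 2.5] [cite: Lehman1970, §3] -/
def Trudgian2011_lemma_2_5 : Prop :=
  ∀ t : ℝ, 128 * π ≤ t → ‖riemannZeta (1 / 2 + t * I)‖ ≤ 2.53 * t ^ (1 / 4 : ℝ)

/-- NAMED FACT (**Trudgian 2011, footnote 3** to Lemma 2.5): "A computational check shows that
Lemma 2.5 in fact holds for all `t > 1`", i.e. `|ζ(½ + it)| ≤ 2.53 t^{1/4}` for `t > 1`.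
Users take `(h : Trudgian2011_lemma_2_5_allT)`. [cite: Trudgian2011, Lemma 2.5 footnote 3] -/
def Trudgian2011_lemma_2_5_allT : Prop :=
  ∀ t : ℝ, 1 < t → ‖riemannZeta (1 / 2 + t * I)‖ ≤ 2.53 * t ^ (1 / 4 : ℝ)

/-- The footnote form implies the printed lemma. [cite: Trudgian2011, Lemma 2.5] -/
theorem Trudgian2011_lemma_2_5_allT.lemma_2_5 (h : Trudgian2011_lemma_2_5_allT) :
    Trudgian2011_lemma_2_5 := fun t ht ↦
  h t (lt_of_lt_of_le (by linarith [Real.pi_gt_three]) ht)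

/-- The elementary bound on the unit segment of the critical line: for `|u| ≤ 1`,
`|ζ(½ + iu)| ≤ 1 + √5` (`|ζ(s)| ≤ |s|/|s−1| + |s|/σ`, `|s| = |s−1| ≤ √5/2`). [folklore] -/
theorem norm_riemannZeta_half_line_le_of_abs_le_one {u : ℝ} (hu : |u| ≤ 1) :
    ‖riemannZeta (1 / 2 + u * I)‖ ≤ 1 + Real.sqrt 5 := by
  set s : ℂ := 1 / 2 + u * I with hs
  have hre : s.re = 1 / 2 := by simp [hs]
  have hs1 : s ≠ 1 := fun h ↦ by have := congrArg Complex.re h; rw [hre] at this; norm_num at this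
  have h := LFunctions.norm_riemannZeta_le_of_re_pos (s := s) (by rw [hre]; norm_num) hs1
  have hns : ‖s‖ = Real.sqrt (1 / 4 + u ^ 2) := by
    have : s = ((1 / 2 : ℝ) : ℂ) + u * I := by simp [hs]
    rw [this, Complex.norm_add_mul_I]; norm_num
  have hns1 : ‖s - 1‖ = Real.sqrt (1 / 4 + u ^ 2) := by
    have : s - 1 = ((-(1 / 2) : ℝ) : ℂ) + u * I := by simp [hs]; ring
    rw [this, Complex.norm_add_mul_I]; norm_num
  have hpos : 0 < Real.sqrt (1 / 4 + u ^ 2) := Real.sqrt_pos.2 (by positivity)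
  have hsq : Real.sqrt (1 / 4 + u ^ 2) ≤ Real.sqrt 5 / 2 := by
    rw [show Real.sqrt 5 / 2 = Real.sqrt (5 / 4) by
      rw [Real.sqrt_div' _ (by norm_num : (0:ℝ) ≤ 4), show Real.sqrt 4 = 2 by
        rw [show (4:ℝ) = 2 ^ 2 by norm_num, Real.sqrt_sq (by norm_num)]]]
    refine Real.sqrt_le_sqrt ?_
    have : u ^ 2 ≤ 1 := by
      have := abs_le.1 hu; nlinarith
    linarith
  rw [hre, hns, hns1, div_self hpos.ne'] at h
  calc ‖riemannZeta s‖ ≤ 1 + Real.sqrt (1 / 4 + u ^ 2) / (1 / 2) := h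
    _ = 1 + 2 * Real.sqrt (1 / 4 + u ^ 2) := by ring
    _ ≤ 1 + Real.sqrt 5 := by linarith

/-- **The all-`t` critical-line hypothesis of Turing's method from Trudgian's footnote-3 fact**:
`|ζ(½ + iu)| ≤ 2.53 · |5/2 + ½ + iu|^{1/4}` for every real `u` (`K = 2.53`, `Q = 5/2`, `θ = ¼`).
[cite: Trudgian2011, Lemma 2.5 footnote 3] -/
theorem norm_riemannZeta_half_line_le_allT (h : Trudgian2011_lemma_2_5_allT) (u : ℝ) :
    ‖riemannZeta (1 / 2 + u * I)‖ ≤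
      2.53 * ‖((5 / 2 : ℝ) : ℂ) + (1 / 2 + u * I)‖ ^ (1 / 4 : ℝ) := by
  have hQ : ((5 / 2 : ℝ) : ℂ) + (1 / 2 + u * I) = ((3 : ℝ) : ℂ) + u * I := by push_cast; ring
  rw [hQ]
  have hnorm_ge_u : |u| ≤ ‖((3 : ℝ) : ℂ) + u * I‖ := by
    have := abs_im_le_norm (((3 : ℝ) : ℂ) + u * I); simpa using this
  have hnorm_ge_3 : (3 : ℝ) ≤ ‖((3 : ℝ) : ℂ) + u * I‖ := by
    have := abs_re_le_norm (((3 : ℝ) : ℂ) + u * I); simpa using this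
  rcases le_or_gt |u| 1 with hu | hu
  · -- `|u| ≤ 1`: elementary bound `1 + √5 ≤ 2.53 · 3^{1/4}`
    refine (norm_riemannZeta_half_line_le_of_abs_le_one hu).trans ?_
    have h5 : Real.sqrt 5 ≤ 2.2361 := by
      rw [show (2.2361 : ℝ) = Real.sqrt (2.2361 ^ 2) by rw [Real.sqrt_sq (by norm_num)]]
      exact Real.sqrt_le_sqrt (by norm_num)
    have h3 : (1.316 : ℝ) ≤ (3 : ℝ) ^ (1 / 4 : ℝ) := by
      have e : (1.316 : ℝ) = ((1.316 : ℝ) ^ 4) ^ ((4 : ℕ)⁻¹ : ℝ) :=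
        (Real.pow_rpow_inv_natCast (by norm_num) (by norm_num)).symm
      rw [e, show ((4 : ℕ)⁻¹ : ℝ) = 1 / 4 by norm_num]
      exact Real.rpow_le_rpow (by positivity) (by norm_num) (by norm_num)
    have h3' : (3 : ℝ) ^ (1 / 4 : ℝ) ≤ ‖((3 : ℝ) : ℂ) + u * I‖ ^ (1 / 4 : ℝ) :=
      Real.rpow_le_rpow (by norm_num) hnorm_ge_3 (by norm_num)
    nlinarith
  · -- `|u| > 1`: the fact (and conjugation for `u < -1`)
    have key : ‖riemannZeta (1 / 2 + u * I)‖ ≤ 2.53 * |u| ^ (1 / 4 : ℝ) := by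
      rcases le_or_gt 0 u with hu0 | hu0
      · rw [abs_of_nonneg hu0] at hu ⊢; exact h u hu
      · have hneg : 1 < -u := by rw [abs_of_neg hu0] at hu; exact hu
        have hconj : riemannZeta (1 / 2 + u * I) = conj (riemannZeta (1 / 2 + (-u : ℝ) * I)) := by
          rw [← riemannZeta_conj]; congr 1
          apply Complex.ext <;> simp
        rw [hconj, Complex.norm_conj, abs_of_neg hu0]
        exact h (-u) hneg
    refine key.trans ?_
    gcongr

end Literature.NumberTheory.LFunctions
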